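import Summits.Parity.GeneralizedHardyLittlewood.Theses.LeeYangFibres
import Literature.NumberTheory.LFunctions.SelbergPrimeSumEstimates
import Literature.NumberTheory.Sieve.LinearEquationsInPrimesSingularSeries

/-!
# Route `LeeYangFibres`, support `HyperbolicityClipsParity` (stmt-Parity-14114): scale-level inputs

Helper file 5/·: the small facts about the route's inlined objects that the assembly of
`HyperbolicityClipsParity` needs besides the fibre clipping lemma:

* `sum_modelCells_le` — the rough `Ω`-cells `A_m(N)`, `1 ≤ m ≤ u`, are disjoint subsets of `[1, N]`,
  so `∑_m A_m(N) ≤ N`;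
* `modelCell_one_le` — `A_1(N) ≤ π(N) ≤ 5N / log N` (Chebyshev, tree lemma
  `SelbergPrimes.card_primesLE_le`);
* `archFactor_mul_singularProduct_nonneg` — `β_∞ ∏_p β_p ≥ 0` for non-degenerate systems (the
  partial singular products are `≥ 0` and converge, `tendsto_singularProductPartial_holds`);
* `walsh_primeCell_sub_one` / `abs_walsh_primeCell_sub_one_le` — at the prime cell `j = (1,…,1)` the
  Walsh factor is `∑_S θ_S = 1 + ∑_{S ≠ ∅} θ_S`;
* `theta_small_of_fibres` — clipping through every coordinate clips every `θ_S`, `S ≠ ∅`;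
* `fibreSum_cast` — the `ℕ → ℂ` casts of `FibreHyperbolicity` versus `ℕ → ℝ → ℂ`.
-/

namespace Summit.Parity.GeneralizedHardyLittlewood.Theorems.HyperbolicityClipsParity

open Finset Filter Literature.NumberTheory.Sieve

/-- **The cells partition part of `[1, N]`**: `∑_{m=1}^u A_m(N) ≤ N`. -/
theorem sum_modelCells_le (N u : ℕ) :
    ∑ m ∈ Finset.Icc 1 u, ((((Finset.Icc 1 N).filter (fun n => (N : ℝ) ^ ((1 : ℝ) / u) <
        (Nat.minFac n : ℝ) ∧ ArithmeticFunction.cardFactors n = m)).card : ℕ) : ℝ) ≤ N := by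
  have h : ∀ m ∈ Finset.Icc 1 u, ((Finset.Icc 1 N).filter (fun n => (N : ℝ) ^ ((1 : ℝ) / u) <
        (Nat.minFac n : ℝ) ∧ ArithmeticFunction.cardFactors n = m)) =
      (((Finset.Icc 1 N).filter (fun n => (N : ℝ) ^ ((1 : ℝ) / u) < (Nat.minFac n : ℝ))).filter
        (fun n => ArithmeticFunction.cardFactors n = m)) := by
    intro m _
    rw [Finset.filter_filter]
  rw [Finset.sum_congr rfl fun m hm => by rw [h m hm]]
  have := Finset.sum_card_fiberwise_eq_card_filter
    ((Finset.Icc 1 N).filter (fun n => (N : ℝ) ^ ((1 : ℝ) / u) < (Nat.minFac n : ℝ)))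
    (Finset.Icc 1 u) (fun n => ArithmeticFunction.cardFactors n)
  rw [← Nat.cast_sum, this]
  have hle : (((Finset.Icc 1 N).filter (fun n => (N : ℝ) ^ ((1 : ℝ) / u) < (Nat.minFac n : ℝ))).filter
      (fun n => ArithmeticFunction.cardFactors n ∈ Finset.Icc 1 u)).card ≤ (Finset.Icc 1 N).card :=
    (Finset.card_filter_le _ _).trans (Finset.card_filter_le _ _)
  rw [Nat.card_Icc, Nat.add_sub_cancel] at hle
  exact_mod_cast hle

/-- **Chebyshev at the prime cell**: `A_1(N) ≤ π(N) ≤ 5 N / log N` for `N ≥ 2` (an integer with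
`Ω = 1` is a prime). -/
theorem modelCell_one_le {N : ℕ} (hN : 2 ≤ N) (u : ℕ) :
    ((((Finset.Icc 1 N).filter (fun n => (N : ℝ) ^ ((1 : ℝ) / u) < (Nat.minFac n : ℝ) ∧
        ArithmeticFunction.cardFactors n = 1)).card : ℕ) : ℝ) ≤ 5 * N / Real.log N := by
  refine le_trans ?_ (Literature.NumberTheory.LFunctions.SelbergPrimes.card_primesLE_le hN)
  exact_mod_cast Finset.card_le_card fun n hn => by
    rw [Finset.mem_filter, Finset.mem_Icc] at hn
    rw [Nat.mem_primesLE]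
    exact ⟨hn.1.2, ArithmeticFunction.cardFactors_eq_one_iff_prime.1 hn.2.2⟩

/-- **The main-term scale is non-negative**: `β_∞ · ∏_p β_p ≥ 0` for a non-degenerate system
(`β_∞` is a volume; the partial singular products are `≥ 0` and converge to `∏_p β_p`). -/
theorem archFactor_mul_singularProduct_nonneg {d t : ℕ} (Ψ : Fin t → AffLinForm d)
    (hΨ : IsNondegenerateSystem Ψ) (K : Set (Fin d → ℝ)) :
    0 ≤ archFactor Ψ K * singularProduct Ψ := by
  refine mul_nonneg ENNReal.toReal_nonneg ?_
  have hT := tendsto_singularProductPartial_holds d t Ψ hΨ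
  exact ge_of_tendsto' hT fun x => Finset.prod_nonneg fun p _ => localFactor_nonneg Ψ p

/-- **Walsh factor at the prime cell**: with `θ_∅ = 1`,
`∑_S θ_S ∏_{i ∈ S} (-1)^{1+1} - 1 = ∑_{S ≠ ∅} θ_S`. -/
theorem walsh_primeCell_sub_one {t : ℕ} (θ : Finset (Fin t) → ℝ) (hθ : θ ∅ = 1) :
    (∑ S : Finset (Fin t), θ S * ∏ _i ∈ S, (-1 : ℝ) ^ (1 + 1)) - 1 =
      ∑ S ∈ (Finset.univ : Finset (Finset (Fin t))).erase ∅, θ S := by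
  have h1 : ∀ S : Finset (Fin t), θ S * ∏ _i ∈ S, (-1 : ℝ) ^ (1 + 1) = θ S := fun S => by
    rw [Finset.prod_eq_one fun _ _ => by norm_num, mul_one]
  rw [Finset.sum_congr rfl fun S _ => h1 S, ← Finset.add_sum_erase _ _ (Finset.mem_univ ∅), hθ]
  ring

/-- **The prime-cell Walsh factor is close to `1` when the amplitudes are small**:
`|∑_S θ_S ∏ (-1)^2 - 1| ≤ 2^t τ` if `θ_∅ = 1` and `|θ_S| ≤ τ` for `S ≠ ∅`. -/
theorem abs_walsh_primeCell_sub_one_le {t : ℕ} (θ : Finset (Fin t) → ℝ) (hθ : θ ∅ = 1)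
    {τ : ℝ} (hτ0 : 0 ≤ τ) (hτ : ∀ S : Finset (Fin t), S ≠ ∅ → |θ S| ≤ τ) :
    |(∑ S : Finset (Fin t), θ S * ∏ _i ∈ S, (-1 : ℝ) ^ (1 + 1)) - 1| ≤ 2 ^ t * τ := by
  rw [walsh_primeCell_sub_one θ hθ]
  calc |∑ S ∈ (Finset.univ : Finset (Finset (Fin t))).erase ∅, θ S|
      ≤ ∑ S ∈ (Finset.univ : Finset (Finset (Fin t))).erase ∅, |θ S| := Finset.abs_sum_le_sum_abs _ _
    _ ≤ ∑ _S ∈ (Finset.univ : Finset (Finset (Fin t))).erase ∅, τ :=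
        Finset.sum_le_sum fun S hS => hτ S (Finset.ne_of_mem_erase hS)
    _ = (((Finset.univ : Finset (Finset (Fin t))).erase ∅).card : ℝ) * τ := by
        rw [Finset.sum_const, nsmul_eq_mul]
    _ ≤ 2 ^ t * τ := by
        refine mul_le_mul_of_nonneg_right ?_ hτ0
        have : ((Finset.univ : Finset (Finset (Fin t))).erase ∅).card ≤ 2 ^ t := by
          refine (Finset.card_erase_le).trans ?_
          rw [Finset.card_univ, Fintype.card_finset, Fintype.card_fin]
        exact_mod_cast this

/-- **Clipping through every coordinate clips every non-empty amplitude.** -/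
theorem theta_small_of_fibres {t : ℕ} (θ : Finset (Fin t) → ℝ) {τ : ℝ}
    (h : ∀ i : Fin t, ∀ T ∈ (Finset.univ.erase i).powerset, |θ (insert i T)| ≤ τ) :
    ∀ S : Finset (Fin t), S ≠ ∅ → |θ S| ≤ τ := by
  intro S hS
  obtain ⟨i, hi⟩ := Finset.nonempty_iff_ne_empty.2 hS
  have hT : S.erase i ∈ (Finset.univ.erase i).powerset :=
    Finset.mem_powerset.2 (Finset.erase_subset_erase i (Finset.subset_univ S))
  have := h i (S.erase i) hT
  rwa [Finset.insert_erase hi] at this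

/-- **Cast glue for the fibre polynomial**: `FibreHyperbolicity` casts the cell counts `ℕ → ℂ`,
the clipping lemma casts them `ℕ → ℝ → ℂ`. -/
theorem fibreSum_cast {t : ℕ} (box : Finset (Fin t → ℕ)) (cnt : (Fin t → ℕ) → ℕ) (i : Fin t)
    (w : Fin t → ℝ) (z : ℂ) :
    (∑ j ∈ box, (((cnt j : ℕ) : ℝ) : ℂ) * ∏ k, (if k = i then z else ((w k : ℝ) : ℂ)) ^ (j k)) =
      ∑ j ∈ box, ((cnt j : ℕ) : ℂ) * ∏ k, (if k = i then z else ((w k : ℝ) : ℂ)) ^ (j k) :=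
  Finset.sum_congr rfl fun j _ => by rw [Complex.ofReal_natCast]

/-- Normalising the model facts by `N`: lower bound. `c N / log N ≤ A` gives `c / log N ≤ A / N`. -/
theorem density_lower {c N L A : ℝ} (hN : 0 < N) (h : c * N / L ≤ A) : c / L ≤ A / N := by
  rw [le_div_iff₀ hN]; rwa [div_mul_eq_mul_div]

/-- Normalising the model facts by `N`: margins. -/
theorem density_margin {δ N A0 Am1 Ap1 : ℝ} (hN : 0 < N) (h : (1 - δ) * A0 ^ 2 ≤ Am1 * Ap1) :
    (1 - δ) * (A0 / N) ^ 2 ≤ Am1 / N * (Ap1 / N) := by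
  rw [div_pow, div_mul_div_comm, ← mul_div_assoc, ← sq]
  exact div_le_div_of_nonneg_right h (by positivity)

/-- Normalising the model facts by `N`: parity balance, with the sign `(-1)^{n+1} = -(-1)^n`. -/
theorem density_balance {u : ℕ} {δ N : ℝ} (hN : 0 < N) (A : ℕ → ℝ)
    (h : |∑ n ∈ Finset.Icc 1 u, (-1 : ℝ) ^ n * A n| ≤ δ * ∑ n ∈ Finset.Icc 1 u, A n) :
    |∑ n ∈ Finset.Icc 1 u, (-1 : ℝ) ^ (n + 1) * (A n / N)| ≤ δ * ∑ n ∈ Finset.Icc 1 u, A n / N := by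
  have h1 : ∑ n ∈ Finset.Icc 1 u, (-1 : ℝ) ^ (n + 1) * (A n / N) =
      -(∑ n ∈ Finset.Icc 1 u, (-1 : ℝ) ^ n * A n) / N := by
    rw [neg_div, Finset.sum_div, ← Finset.sum_neg_distrib]
    refine Finset.sum_congr rfl fun n _ => ?_
    rw [pow_succ]; ring
  have h2 : ∑ n ∈ Finset.Icc 1 u, A n / N = (∑ n ∈ Finset.Icc 1 u, A n) / N := by
    rw [Finset.sum_div]
  rw [h1, h2, abs_div, abs_neg, abs_of_pos hN, mul_div_assoc', div_le_div_iff_of_pos_right hN]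
  exact h

end Summit.Parity.GeneralizedHardyLittlewood.Theorems.HyperbolicityClipsParity
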